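import Summits.NavierStokesRegularity.NavierStokesRegularity.Theorems.TypeICertificateLadderStrainRateWeightedVorticity
import Summits.NavierStokesRegularity.NavierStokesRegularity.Theorems.TypeICertificateLadderRungReynoldsOneTaoCover
import Literature.Analysis.FluidPDE.NSVorticityBKMHolds
import Literature.Analysis.FluidPDE.PutativeSelfSimilarEulerProofs
import Literature.Analysis.FluidPDE.ParabolicComparison
import HarnessLib

/-!
# Route TypeICertificateLadder — the explicit DIRECTIONAL-STRETCHING-rate constant `1` at a singular
  time (the finite-time twin of the cell's T35; sharpening of C32; helper of crux
  stmt-NavierStokesRegularity-2882)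

**C35.** Let `(u, p)` be a classical solution of unforced Navier–Stokes (`ν = 1`) on `ℝ³ × [0, T)` in
the Beale–Kato–Majda class (all `L²` Sobolev norms bounded on every `[0, T'']`, `T'' < T`) which
cannot be continued in that class past `T`. Then for every `θ < 1`, frequently as `t ↑ T`, some
point `x` WITH `ω(t,x) ≠ 0` has
`θ < (T − t)·(⟪∇u(t,x) ξ, ξ⟫ − |∇ξ(t,x)|²_F)`, `ξ = ω/|ω|` the vorticity direction:
the stretching rate ALONG the vorticity direction, net of the direction-incoherence
`|∇ξ|²_F`, must reach `θ/(T − t)` for every `θ < 1` (Constantin–Fefferman's geometric depletion made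
quantitative with the explicit constant `1`; since `⟪∇u ξ, ξ⟫ − |∇ξ|²_F ≤ λ_max(S)`, this sharpens
C32, `TypeICertificateLadderStrainRateThresholdOne.lean`). Elementary, NO Liouville theorem: under
the bound, Kato's inequality with the trivial certificate `h ≡ 1` (tree: `stretchCert_slice`,
Constantin 1990 (2.9)) makes `P = (T − t)^{2θ}|ω|²` a subsolution of `∂ₜP ≤ ΔP − u·∇P` wherever
`ω ≠ 0`, and a zero of `ω` is a space–time minimum of `P ≥ 0`; the whole-space weak maximum
principle (`le_of_subsolution_linear_drift`) and the Beale–Kato–Majda criterion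
(`beale_kato_majda_holds`) conclude as for C32.

* `weightedVorticity_le_of_directionalStretching_bound` — the a-priori estimate.
* `directionalStretching_frequently_gt_of_not_hasSobolevExtensionPast` (C35, BKM class),
  `directionalStretching_frequently_gt_of_not_hasSmoothExtensionPast`,
  `typeICertificateLadder_directionalStretching_frequently_gt` (Fefferman / Leray–Hopf class via the
  landed `stub_taoCover`).

HONEST FRAMING: statements about a HYPOTHETICAL singular time; no such solution is asserted to
exist; `1` is the threshold of this elementary argument and nothing is said at or above it;
nothing here bears on the regularity question itself. Lands `--supports stmt-NavierStokesRegularity-2882`.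
-/

noncomputable section

namespace Summit.NavierStokesRegularity.NavierStokesRegularity.Theorems

set_option linter.dupNamespace false

open MeasureTheory Set Filter Topology Function
open scoped RealInnerProductSpace Laplacian ContDiff
open Literature.Analysis Literature.Analysis.FluidPDE

/-! ### The weighted vorticity bound under the directional stretching bound -/

/-- **`(T − t)^{2θ}‖ω(t,x)‖² ≤ (T − t₀)^{2θ} sup‖ω(t₀)‖²` on `[t₀, T)` under the DIRECTIONAL
stretching bound.** Let `(u, p)` be a classical solution of unforced Navier–Stokes (`ν = 1`) on
`ℝ³ × [0,T)` in the BKM class on every `[0,T'']`, `T'' < T`, and suppose that at every point of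
`(t₀, T) × ℝ³` with `ω = curl u(t) ≠ 0`,
`(T − t)(⟪∇u(t,x) ξ, ξ⟫ − |∇ξ|²_F) ≤ θ` (`ξ` the vorticity direction, `0 < t₀ < T`, `0 ≤ θ`). Then
`(T − t)^{2θ}‖ω(t,x)‖² ≤ (T − t₀)^{2θ}(‖curlCLM‖ sup‖∇u(t₀)‖)²` on `[t₀, T)`. Kato's inequality with the
trivial certificate (`stretchCert_slice` with `k ≡ 1`, `δ = 1 − θ`, `mt = T − t`) at points with
`ω ≠ 0`, the space–time minimum of `P ≥ 0` at zeros of `ω`, the BKM-class sup bounds, and the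
whole-space weak maximum principle `le_of_subsolution_linear_drift`. [cite: Constantin1990, (2.9)] -/
theorem weightedVorticity_le_of_directionalStretching_bound {T θ t₀ : ℝ} (hθ : 0 ≤ θ)
    (ht₀ : 0 < t₀) (ht₀T : t₀ < T)
    {u : ℝ → EuclideanSpace ℝ (Fin 3) → EuclideanSpace ℝ (Fin 3)}
    {p : ℝ → EuclideanSpace ℝ (Fin 3) → ℝ}
    (hsol : IsClassicalNSSolutionOn (Ico 0 T) 1 0 u p)
    (hreg : ∀ T'' < T, HasBoundedSobolevNormsOn (Icc 0 T'') u)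
    (hstretch : ∀ t ∈ Ioo t₀ T, ∀ x, curl (u t) x ≠ 0 →
      (T - t) * (⟪fderiv ℝ (u t) x (vorticityDirection (curl (u t)) x),
          vorticityDirection (curl (u t)) x⟫
        - frobeniusNormSq (fderiv ℝ (vorticityDirection (curl (u t))) x)) ≤ θ) :
    ∃ M : ℝ, ∀ t ∈ Ico t₀ T, ∀ x, (T - t) ^ (2 * θ) * ‖curl (u t) x‖ ^ 2 ≤ M := by
  -- the solution on the open slab and its vorticity equation (two-sided time derivative)
  have hsolo : IsClassicalNSSolutionOn (Ioo 0 T) 1 0 u p :=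
    hsol.mono Ioo_subset_Ico_self isOpen_Ioo.uniqueDiffOn
  have hsm : IsSmoothSpaceTimeOn (Ioo 0 T) u := hsolo.smooth_velocity
  have hvort : IsSmoothSpaceTimeOn (Ioo 0 T) (vorticity u) := by
    have h1 := (hsm.isSmoothSpaceTimeOn_fderiv_of_isOpen isOpen_Ioo).clm curlCLM
    have e : (fun t x => curlCLM (fderiv ℝ (u t) x)) = vorticity u := by funext s y; rfl
    rwa [e] at h1
  have hV := hsolo.isVorticitySolutionOn_zero_force isOpen_Ioo.uniqueDiffOn
    (by rw [interior_Ioo]; exact subset_closure)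
  have hveq : ∀ t ∈ Ioo 0 T, ∀ x,
      deriv (fun s => curl (u s) x) t + fderiv ℝ (curl (u t)) x (u t x) =
        fderiv ℝ (u t) x (curl (u t) x) + (Δ (curl (u t))) x := by
    intro t ht x
    have h := hV.vorticity_eq t ht x
    simp only [timeDerivWithin_eq_deriv isOpen_Ioo ht, convect_apply, vorticity_apply,
      one_smul] at h
    exact h
  -- smoothness of the slices
  have hsmooth : ∀ t ∈ Ico 0 T, ContDiff ℝ ∞ (u t) := fun t ht => hsol.contDiff_velocity ht
  -- the bound at the initial time `t₀`
  obtain ⟨B₁, hB₁0, hB₁⟩ := exists_forall_norm_iteratedFDeriv_le_bkmClass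
    (fun t ht => hsmooth t ⟨ht.1, ht.2.trans_lt ht₀T⟩) (hreg t₀ ht₀T) 1
  set κ₀ : ℝ := ‖(curlCLM : (EuclideanSpace ℝ (Fin 3) →L[ℝ] EuclideanSpace ℝ (Fin 3)) →L[ℝ]
    EuclideanSpace ℝ (Fin 3))‖ with hκ₀
  have hκ₀0 : 0 ≤ κ₀ := by rw [hκ₀]; positivity
  have hcurl_le : ∀ (f : EuclideanSpace ℝ (Fin 3) → EuclideanSpace ℝ (Fin 3)) (x),
      ‖curl f x‖ ≤ κ₀ * ‖iteratedFDeriv ℝ 1 f x‖ := fun f x => by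
    rw [curl_eq_curlCLM, ← norm_iteratedFDeriv_fderiv, norm_iteratedFDeriv_zero]
    exact ContinuousLinearMap.le_opNorm _ _
  set M : ℝ := (T - t₀) ^ (2 * θ) * (κ₀ * B₁) ^ 2 with hMdef
  refine ⟨M, fun t ht x => ?_⟩
  have hω₀ : ∀ y, ‖curl (u t₀) y‖ ≤ κ₀ * B₁ := fun y =>
    (hcurl_le _ y).trans (mul_le_mul_of_nonneg_left (hB₁ t₀ ⟨ht₀.le, le_rfl⟩ y) hκ₀0)
  have hPt₀ : ∀ y, (T - t₀) ^ (2 * θ) * ‖curl (u t₀) y‖ ^ 2 ≤ M := fun y => by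
    rw [hMdef]
    refine mul_le_mul_of_nonneg_left ?_ (Real.rpow_nonneg (sub_pos.2 ht₀T).le _)
    exact pow_le_pow_left₀ (norm_nonneg _) (hω₀ y) 2
  rcases ht.1.eq_or_lt with rfl | ht₀t
  · exact hPt₀ x
  -- the maximum principle on `[t₀, T₂]`, `T₂ = t`
  set T₂ : ℝ := t with hT₂
  have hT₂T : T₂ < T := ht.2
  obtain ⟨K, hK0, hK⟩ := exists_forall_norm_iteratedFDeriv_le_bkmClass
    (fun s hs => hsmooth s ⟨hs.1, hs.2.trans_lt hT₂T⟩) (hreg T₂ hT₂T) 0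
  obtain ⟨B₂, hB₂0, hB₂⟩ := exists_forall_norm_iteratedFDeriv_le_bkmClass
    (fun s hs => hsmooth s ⟨hs.1, hs.2.trans_lt hT₂T⟩) (hreg T₂ hT₂T) 1
  have huK : ∀ s ∈ Icc 0 T₂, ∀ y, ‖u s y‖ ≤ K := fun s hs y => by
    have h := hK s hs y
    rwa [norm_iteratedFDeriv_zero] at h
  have hωB : ∀ s ∈ Icc 0 T₂, ∀ y, ‖curl (u s) y‖ ≤ κ₀ * B₂ := fun s hs y =>
    (hcurl_le _ y).trans (mul_le_mul_of_nonneg_left (hB₂ s hs y) hκ₀0)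
  -- the weighted density and its time derivative
  set P : ℝ → EuclideanSpace ℝ (Fin 3) → ℝ :=
    fun s y => (T - s) ^ (2 * θ) * ‖curl (u s) y‖ ^ 2 with hPdef
  set Pₜ : ℝ → EuclideanSpace ℝ (Fin 3) → ℝ := fun s y =>
    (-1) * (2 * θ) * (T - s) ^ (2 * θ - 1) * ‖curl (u s) y‖ ^ 2 +
      (T - s) ^ (2 * θ) * (2 * ⟪curl (u s) y, deriv (fun σ => curl (u σ) y) s⟫) with hPₜdef
  have hIoc_sub : ∀ {s}, s ∈ Ioc t₀ T₂ → s ∈ Ioo 0 T := fun {s} hs =>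
    ⟨ht₀.trans hs.1, hs.2.trans_lt hT₂T⟩
  have hIcc_sub : ∀ {s}, s ∈ Icc t₀ T₂ → s ∈ Ioo 0 T := fun {s} hs =>
    ⟨ht₀.trans_le hs.1, hs.2.trans_lt hT₂T⟩
  have hPnn : ∀ s < T, ∀ y, 0 ≤ P s y := fun s hs y =>
    mul_nonneg (Real.rpow_nonneg (sub_pos.2 hs).le _) (sq_nonneg _)
  have hPderiv : ∀ s ∈ Ioo 0 T, ∀ y, HasDerivAt (fun σ => P σ y) (Pₜ s y) s := by
    intro s hs' y
    have hTs : 0 < T - s := sub_pos.2 hs'.2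
    have hw : HasDerivAt (fun σ => (T - σ) ^ (2 * θ)) ((-1) * (2 * θ) * (T - s) ^ (2 * θ - 1)) s := by
      have h := ((hasDerivAt_id s).const_sub T).rpow_const (p := 2 * θ) (Or.inl hTs.ne')
      simpa using h
    have hωt : HasDerivAt (fun σ => curl (u σ) y) (deriv (fun σ => curl (u σ) y) s) s := by
      have h := hvort.hasDerivAt_timeLine isOpen_Ioo hs' y
      simpa only [vorticity_apply] using h
    exact hw.mul hωt.norm_sq
  have key := le_of_subsolution_linear_drift (T₁ := t₀) (T₂ := T₂) (M := M)
    (B := T ^ (2 * θ) * (κ₀ * B₂) ^ 2) (K := K) (P := P) (Pₜ := Pₜ) hK0 ?_ ?_ ?_ ?_ ?_ ?_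
  · exact key t ⟨ht₀t.le, le_rfl⟩ x
  · -- joint continuity on `[t₀, T₂] × ℝ³`
    have hw : Continuous fun z : ℝ × EuclideanSpace ℝ (Fin 3) => (T - z.1) ^ (2 * θ) :=
      (continuous_const.sub continuous_fst).rpow_const fun _ => Or.inr (by positivity)
    have hωc : ContinuousOn (fun z : ℝ × EuclideanSpace ℝ (Fin 3) => ‖vorticity u z.1 z.2‖ ^ 2)
        (Icc t₀ T₂ ×ˢ univ) := by
      refine ((hvort.continuousOn.mono ?_).norm).pow 2
      exact prod_mono (fun s hs => hIcc_sub hs) subset_rfl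
    refine (hw.continuousOn.mul hωc).congr fun z _ => ?_
    simp only [hPdef, uncurry, Pi.mul_apply, vorticity_apply]
  · -- `C²` slices
    intro s hs
    have hω : ContDiff ℝ 2 (curl (u s)) := by
      rw [← vorticity_apply]
      exact (hvort.contDiff_slice (hIoc_sub hs)).of_le (by norm_cast)
    exact contDiff_const.mul (hω.norm_sq ℝ)
  · -- time derivative
    intro s hs y
    exact hPderiv s (hIoc_sub hs) y
  · -- the subsolution inequality `Pₜ ≤ ΔP + K (1 + ‖y‖) ‖∇P‖`
    intro s hs y
    have hs' := hIoc_sub hs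
    have hTs : 0 < T - s := sub_pos.2 hs'.2
    have hω2 : ContDiff ℝ 2 (curl (u s)) := by
      rw [← vorticity_apply]
      exact (hvort.contDiff_slice hs').of_le (by norm_cast)
    have hωd : DifferentiableAt ℝ (curl (u s)) y := (hω2.differentiable (by norm_num)) y
    set c : ℝ := (T - s) ^ (2 * θ) with hcdef
    have hc0 : 0 ≤ c := Real.rpow_nonneg hTs.le _
    have hF2 : ContDiff ℝ 2 (fun z => ‖curl (u s) z‖ ^ 2) := hω2.norm_sq ℝ
    have hPs : P s = c • fun z => ‖curl (u s) z‖ ^ 2 := by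
      funext z; simp only [hPdef, Pi.smul_apply, smul_eq_mul, hcdef]
    have hP2 : ContDiff ℝ 2 (P s) := by rw [hPs]; exact hF2.const_smul c
    by_cases hω : curl (u s) y = 0
    · -- a zero of the vorticity: space–time minimum of `P ≥ 0`
      have hP0 : P s y = 0 := by simp [hPdef, hω]
      have hminx : IsLocalMin (P s) y :=
        Filter.Eventually.of_forall fun z => by rw [hP0]; exact hPnn s hs'.2 z
      have hmint : IsLocalMin (fun σ => P σ y) s := by
        filter_upwards [Iio_mem_nhds hs'.2] with σ hσ
        rw [hP0]
        exact hPnn σ hσ y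
      have hD : fderiv ℝ (P s) y = 0 := hminx.fderiv_eq_zero
      have hdt : Pₜ s y = 0 := by
        rw [← (hPderiv s hs' y).deriv]; exact hmint.deriv_eq_zero
      have hΔ : 0 ≤ (Δ (P s)) y := by
        have h1 : (Δ (fun z => -P s z)) y ≤ 0 := IsLocalMax.laplacian_nonpos hP2.neg hminx.neg
        have e : (fun z => -P s z) = -(P s) := rfl
        rw [e, InnerProductSpace.laplacian_neg, Pi.neg_apply, neg_nonpos] at h1
        exact h1
      rw [hdt, hD, norm_zero, mul_zero, add_zero]
      exact hΔ
    · -- Kato's inequality with the trivial certificate `k ≡ 1`, `δ = 1 − θ`, `mt = T − s`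
      have hk : ContDiff ℝ 2 (fun _ : EuclideanSpace ℝ (Fin 3) => (1 : ℝ)) := contDiff_const
      have htime : 2 * ⟪curl (u s) y, deriv (fun σ => curl (u σ) y) s⟫ =
          (1 : ℝ) ^ 2 * (2 * ⟪curl (u s) y, deriv (fun σ => curl (u σ) y) s⟫) +
            2 * (‖curl (u s) y‖ ^ 2 / (1 : ℝ) ^ 2) * 1 * 0 := by ring
      have hcert : ((T - s) * (⟪fderiv ℝ (u s) y (vorticityDirection (curl (u s)) y),
            vorticityDirection (curl (u s)) y⟫
          - frobeniusNormSq (fderiv ℝ (vorticityDirection (curl (u s))) y)) - 1 + (1 - θ)) * 1 ≤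
          (T - s) * (0 + fderiv ℝ (fun _ : EuclideanSpace ℝ (Fin 3) => (1 : ℝ)) y (u s y)
            - (Δ (fun _ : EuclideanSpace ℝ (Fin 3) => (1 : ℝ))) y) := by
        have h1 := hstretch s ⟨hs.1, hs'.2⟩ y hω
        simp only [fderiv_const_apply, zero_apply,
          InnerProductSpace.laplacian_const, Pi.zero_apply, zero_add, sub_zero, mul_zero, mul_one]
        linarith
      have kato := stretchCert_slice (v := u s) (k := fun _ => (1 : ℝ)) hω2 hk (fun _ => one_ne_zero)
        hω one_pos (kt := 0) (δ := 1 - θ) hTs htime (hveq s hs' y) hcert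
      -- translate `‖ω‖²/1²` to `‖ω‖²`
      have eF : (fun z => ‖curl (u s) z‖ ^ 2 / (fun _ : EuclideanSpace ℝ (Fin 3) => (1 : ℝ)) z ^ 2) =
          fun z => ‖curl (u s) z‖ ^ 2 := by
        funext z; simp
      rw [eF] at kato
      simp only [fderiv_const_apply, zero_apply, mul_zero,
        Finset.sum_const_zero, add_zero, one_pow, div_one, inv_one] at kato
      -- kato : Ft + ∇F·u − ΔF ≤ 2(1 − (1−θ))/(T−s) · F
      have hLap : (Δ (P s)) y = c * (Δ (fun z => ‖curl (u s) z‖ ^ 2)) y := by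
        rw [hPs, InnerProductSpace.laplacian_smul c (hF2.contDiffAt), smul_eq_mul]
      have hgrad : ∀ w, fderiv ℝ (P s) y w = c * fderiv ℝ (fun z => ‖curl (u s) z‖ ^ 2) y w := by
        intro w
        rw [hPs, fderiv_const_smul ((hF2.differentiable (by norm_num)) y),
          FunLike.coe_smul, Pi.smul_apply, smul_eq_mul]
      have hc' : (-1) * (2 * θ) * (T - s) ^ (2 * θ - 1) = -(2 * (θ / (T - s))) * c := by
        rw [hcdef, Real.rpow_sub_one hTs.ne']
        field_simp
      -- the drift bound
      have hdrift : -(fderiv ℝ (P s) y (u s y)) ≤ K * (1 + ‖y‖) * ‖fderiv ℝ (P s) y‖ := by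
        have h1 : -(fderiv ℝ (P s) y (u s y)) ≤ ‖fderiv ℝ (P s) y‖ * ‖u s y‖ :=
          (neg_le_abs _).trans ((Real.norm_eq_abs _).symm.le.trans (ContinuousLinearMap.le_opNorm _ _))
        have h2 : ‖fderiv ℝ (P s) y‖ * ‖u s y‖ ≤ ‖fderiv ℝ (P s) y‖ * K :=
          mul_le_mul_of_nonneg_left (huK s ⟨hs'.1.le, hs.2⟩ y) (norm_nonneg _)
        have h3 : ‖fderiv ℝ (P s) y‖ * K ≤ K * (1 + ‖y‖) * ‖fderiv ℝ (P s) y‖ := by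
          have : 0 ≤ K * ‖y‖ * ‖fderiv ℝ (P s) y‖ := by positivity
          nlinarith
        linarith
      show Pₜ s y ≤ (Δ (P s)) y + K * (1 + ‖y‖) * ‖fderiv ℝ (P s) y‖
      have e1 : Pₜ s y = (-1) * (2 * θ) * (T - s) ^ (2 * θ - 1) * ‖curl (u s) y‖ ^ 2 +
          c * (2 * ⟪curl (u s) y, deriv (fun σ => curl (u σ) y) s⟫) := rfl
      rw [e1, hc', hLap]
      have e2 := hgrad (u s y)
      have hθs : 2 * (1 - (1 - θ)) / (T - s) = 2 * (θ / (T - s)) := by ring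
      rw [hθs] at kato
      -- multiply Kato by `c ≥ 0`
      have hck := mul_le_mul_of_nonneg_left kato hc0
      nlinarith [hck, hdrift, e2, hc0, sq_nonneg ‖curl (u s) y‖]
  · -- bounded above on `[t₀, T₂] × ℝ³`
    intro s hs y
    have hs' := hIcc_sub hs
    have hTs : 0 < T - s := sub_pos.2 hs'.2
    have hw : (T - s) ^ (2 * θ) ≤ T ^ (2 * θ) :=
      Real.rpow_le_rpow hTs.le (by linarith [hs'.1]) (by positivity)
    have hωb : ‖curl (u s) y‖ ^ 2 ≤ (κ₀ * B₂) ^ 2 :=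
      pow_le_pow_left₀ (norm_nonneg _) (hωB s ⟨hs'.1.le, hs.2⟩ y) 2
    exact mul_le_mul hw hωb (sq_nonneg _) (Real.rpow_nonneg (ht₀.le.trans ht₀T.le) _)
  · -- the initial slice
    exact hPt₀

/-! ### C35: the directional stretching rate exceeds `θ/(T − t)`, `θ < 1`, at a singular time -/

/-- **C35 (BKM class, `ν = 1`).** Let `(u, p)` be a classical solution of unforced Navier–Stokes
(`ν = 1`) on `ℝ³ × [0,T)`, `T > 0`, with all `L²` Sobolev norms bounded on every `[0,T'']`, `T'' < T`,
which cannot be continued in this class past `T` (`¬ HasSobolevExtensionPast`). Then for every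
`θ < 1`, frequently as `t ↑ T`, some point `x` with `ω(t,x) ≠ 0` has
`θ < (T − t)(⟪∇u(t,x) ξ, ξ⟫ − |∇ξ|²_F)`, `ξ = ω/|ω|`:
`limsup_{t↑T} (T − t) sup_{ω ≠ 0} (ξ·Sξ − |∇ξ|²_F) ≥ 1`. Otherwise
`weightedVorticity_le_of_directionalStretching_bound` gives `‖ω(t)‖_∞ ≤ √M (T − t)^{−θ'}`
(`θ' = max θ ½`), integrable on `(0,T)`, and the Beale–Kato–Majda criterion (`beale_kato_majda_holds`)
continues the solution. [this file; Beale–Kato–Majda 1984 Thm 1; Constantin–Fefferman 1993 §1] -/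
theorem directionalStretching_frequently_gt_of_not_hasSobolevExtensionPast {T : ℝ} (hT : 0 < T)
    {u : ℝ → EuclideanSpace ℝ (Fin 3) → EuclideanSpace ℝ (Fin 3)}
    {p : ℝ → EuclideanSpace ℝ (Fin 3) → ℝ}
    (hsol : IsClassicalNSSolutionOn (Ico 0 T) 1 0 u p)
    (hreg : ∀ T'' < T, HasBoundedSobolevNormsOn (Icc 0 T'') u)
    (hmax : ¬ HasSobolevExtensionPast 1 u T) {θ : ℝ} (hθ : θ < 1) :
    ∃ᶠ t in 𝓝[<] T, ∃ x, curl (u t) x ≠ 0 ∧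
      θ < (T - t) * (⟪fderiv ℝ (u t) x (vorticityDirection (curl (u t)) x),
          vorticityDirection (curl (u t)) x⟫
        - frobeniusNormSq (fderiv ℝ (vorticityDirection (curl (u t))) x)) := by
  by_contra h
  simp only [Filter.not_frequently, not_exists, not_and, not_lt] at h
  -- the bound with `θ' = max θ ½ ∈ (0, 1)` on a window `(t₀, T)`
  set θ' : ℝ := max θ (1 / 2) with hθ'def
  have hθ'0 : 0 < θ' := lt_of_lt_of_le one_half_pos (le_max_right _ _)
  have hθ'1 : θ' < 1 := max_lt hθ (by norm_num)
  have h' : ∀ᶠ t in 𝓝[<] T, ∀ x, curl (u t) x ≠ 0 →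
      (T - t) * (⟪fderiv ℝ (u t) x (vorticityDirection (curl (u t)) x),
          vorticityDirection (curl (u t)) x⟫
        - frobeniusNormSq (fderiv ℝ (vorticityDirection (curl (u t))) x)) ≤ θ' :=
    h.mono fun t ht x hx => (ht x hx).trans (le_max_left _ _)
  obtain ⟨T₀, hT₀T, hT₀⟩ := mem_nhdsLT_iff_exists_Ioo_subset.1 h'
  set t₀ : ℝ := max T₀ (T / 2) with ht₀def
  have ht₀T : t₀ < T := max_lt hT₀T (by linarith)
  have ht₀0 : 0 < t₀ := lt_of_lt_of_le (by linarith) (le_max_right _ _)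
  have hstretch : ∀ t ∈ Ioo t₀ T, ∀ x, curl (u t) x ≠ 0 →
      (T - t) * (⟪fderiv ℝ (u t) x (vorticityDirection (curl (u t)) x),
          vorticityDirection (curl (u t)) x⟫
        - frobeniusNormSq (fderiv ℝ (vorticityDirection (curl (u t))) x)) ≤ θ' := fun t ht =>
    hT₀ ⟨lt_of_le_of_lt (le_max_left _ _) ht.1, ht.2⟩
  obtain ⟨M, hM⟩ := weightedVorticity_le_of_directionalStretching_bound hθ'0.le ht₀0 ht₀T hsol
    hreg hstretch
  have hM0 : 0 ≤ M := le_trans (mul_nonneg (Real.rpow_nonneg (sub_pos.2 ht₀T).le _) (sq_nonneg _))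
    (hM t₀ ⟨le_rfl, ht₀T⟩ 0)
  -- the vorticity bound on `[0, t₀]`
  have hsmooth : ∀ t ∈ Ico 0 T, ContDiff ℝ ∞ (u t) := fun t ht => hsol.contDiff_velocity ht
  obtain ⟨B₁, hB₁0, hB₁⟩ := exists_forall_norm_iteratedFDeriv_le_bkmClass
    (fun t ht => hsmooth t ⟨ht.1, ht.2.trans_lt ht₀T⟩) (hreg t₀ ht₀T) 1
  set κ₀ : ℝ := ‖(curlCLM : (EuclideanSpace ℝ (Fin 3) →L[ℝ] EuclideanSpace ℝ (Fin 3)) →L[ℝ]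
    EuclideanSpace ℝ (Fin 3))‖ with hκ₀
  have hκ₀0 : 0 ≤ κ₀ := by rw [hκ₀]; positivity
  have hcurl_le : ∀ (f : EuclideanSpace ℝ (Fin 3) → EuclideanSpace ℝ (Fin 3)) (x),
      ‖curl f x‖ ≤ κ₀ * ‖iteratedFDeriv ℝ 1 f x‖ := fun f x => by
    rw [curl_eq_curlCLM, ← norm_iteratedFDeriv_fderiv, norm_iteratedFDeriv_zero]
    exact ContinuousLinearMap.le_opNorm _ _
  -- the pointwise bound `‖ω(t,x)‖ ≤ Kc (T − t)^{−θ'}` on `(0,T) × ℝ³`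
  set Kc : ℝ := max (κ₀ * B₁ * T ^ θ') (Real.sqrt M) with hKc
  have hbound : ∀ t ∈ Ioo 0 T, ∀ x, ‖curl (u t) x‖ ≤ Kc * (T - t) ^ (-θ') := by
    intro t ht x
    have hTt : 0 < T - t := sub_pos.2 ht.2
    have hpow : 0 < (T - t) ^ θ' := Real.rpow_pos_of_pos hTt _
    rw [Real.rpow_neg hTt.le, ← div_eq_mul_inv, le_div_iff₀ hpow]
    rcases lt_or_ge t t₀ with hlt | hge
    · have h1 : ‖curl (u t) x‖ ≤ κ₀ * B₁ :=
        (hcurl_le _ x).trans (mul_le_mul_of_nonneg_left (hB₁ t ⟨ht.1.le, hlt.le⟩ x) hκ₀0)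
      have h2 : (T - t) ^ θ' ≤ T ^ θ' :=
        Real.rpow_le_rpow hTt.le (by linarith [ht.1]) hθ'0.le
      calc ‖curl (u t) x‖ * (T - t) ^ θ'
          ≤ κ₀ * B₁ * T ^ θ' := mul_le_mul h1 h2 hpow.le (by positivity)
        _ ≤ Kc := le_max_left _ _
    · have h1 := hM t ⟨hge, ht.2⟩ x
      have e2 : ((T - t) ^ θ') ^ 2 = (T - t) ^ (2 * θ') := by
        rw [← Real.rpow_two, ← Real.rpow_mul hTt.le]
        congr 1
        ring
      have e : (‖curl (u t) x‖ * (T - t) ^ θ') ^ 2 = (T - t) ^ (2 * θ') * ‖curl (u t) x‖ ^ 2 := by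
        rw [mul_pow, e2, mul_comm]
      have h2 : (‖curl (u t) x‖ * (T - t) ^ θ') ^ 2 ≤ M := by rw [e]; exact h1
      have h3 : ‖curl (u t) x‖ * (T - t) ^ θ' ≤ Real.sqrt M := by
        rw [← Real.sqrt_sq (by positivity : 0 ≤ ‖curl (u t) x‖ * (T - t) ^ θ')]
        exact Real.sqrt_le_sqrt h2
      exact h3.trans (le_max_right _ _)
  -- hence `∫₀ᵀ ‖ω(t)‖_{L^∞} dt < ∞`, and BKM continues the solution past `T`
  have hfin : (∫⁻ t in Ioo 0 T, ⨆ x, ‖curl (u t) x‖ₑ) < ⊤ := by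
    refine lt_of_le_of_lt (setLIntegral_mono' measurableSet_Ioo fun t ht => ?_)
      (CIV2026.lintegral_Ioo_rpow_neg_lt_top Kc hθ'1)
    refine iSup_le fun x => ?_
    rw [← ofReal_norm]
    exact ENNReal.ofReal_le_ofReal (hbound t ht x)
  exact hmax ((beale_kato_majda_holds zero_le_one hT hsol hreg).2 hfin)

/-- **C35, smooth-extension phrasing** (`¬ HasSmoothExtensionPast 1 0 u T`, which a Sobolev-class
continuation would provide, `HasSobolevExtensionPast.hasSmoothExtensionPast`). [this file] -/
theorem directionalStretching_frequently_gt_of_not_hasSmoothExtensionPast {T : ℝ} (hT : 0 < T)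
    {u : ℝ → EuclideanSpace ℝ (Fin 3) → EuclideanSpace ℝ (Fin 3)}
    {p : ℝ → EuclideanSpace ℝ (Fin 3) → ℝ}
    (hsol : IsClassicalNSSolutionOn (Ico 0 T) 1 0 u p)
    (hreg : ∀ T'' < T, HasBoundedSobolevNormsOn (Icc 0 T'') u)
    (hsing : ¬ HasSmoothExtensionPast 1 0 u T) {θ : ℝ} (hθ : θ < 1) :
    ∃ᶠ t in 𝓝[<] T, ∃ x, curl (u t) x ≠ 0 ∧
      θ < (T - t) * (⟪fderiv ℝ (u t) x (vorticityDirection (curl (u t)) x),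
          vorticityDirection (curl (u t)) x⟫
        - frobeniusNormSq (fderiv ℝ (vorticityDirection (curl (u t))) x)) :=
  directionalStretching_frequently_gt_of_not_hasSobolevExtensionPast hT hsol hreg
    (fun h => hsing h.hasSmoothExtensionPast) hθ

/-- **C35 in the Fefferman / Leray–Hopf class of the ladder (`ν = 1`).** A classical solution of
unforced Navier–Stokes (`ν = 1`) on `ℝ³ × [0,T)` (`T > 0`), Leray–Hopf on `[0,T]` from its rapidly
decaying datum, with no smooth extension past `T`, satisfies for every `θ < 1`: frequently as
`t ↑ T`, some `x` with `ω(t,x) ≠ 0` has `θ < (T − t)(⟪∇u(t,x) ξ, ξ⟫ − |∇ξ|²_F)`. The BKM-class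
hypothesis is supplied by the landed `stub_taoCover`. [this file] -/
theorem typeICertificateLadder_directionalStretching_frequently_gt {T : ℝ} (hT : 0 < T)
    {u : ℝ → EuclideanSpace ℝ (Fin 3) → EuclideanSpace ℝ (Fin 3)}
    {p : ℝ → EuclideanSpace ℝ (Fin 3) → ℝ}
    (hsol : IsClassicalNSSolutionOn (Ico 0 T) 1 0 u p) (hLH : IsLerayHopfOn T 1 0 (u 0) u)
    (hdec : HasRapidSpatialDecay (u 0)) (hsing : ¬ HasSmoothExtensionPast 1 0 u T)
    {θ : ℝ} (hθ : θ < 1) :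
    ∃ᶠ t in 𝓝[<] T, ∃ x, curl (u t) x ≠ 0 ∧
      θ < (T - t) * (⟪fderiv ℝ (u t) x (vorticityDirection (curl (u t)) x),
          vorticityDirection (curl (u t)) x⟫
        - frobeniusNormSq (fderiv ℝ (vorticityDirection (curl (u t))) x)) := by
  have hreg : ∀ T'' < T, HasBoundedSobolevNormsOn (Icc 0 T'') u := by
    intro T'' hT''
    set T' : ℝ := max T'' (T / 2) with hT'
    have hT'm : T' ∈ Ioo 0 T :=
      ⟨lt_of_lt_of_le (by linarith) (le_max_right _ _), max_lt hT'' (by linarith)⟩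
    obtain ⟨q, -, hB, -, -⟩ := RungReynoldsOne.stub_taoCover one_pos hT hsol hLH hdec hT'm
    exact hB.mono (Icc_subset_Icc_right (le_max_left _ _))
  exact directionalStretching_frequently_gt_of_not_hasSmoothExtensionPast hT hsol hreg hsing hθ

end Summit.NavierStokesRegularity.NavierStokesRegularity.Theorems

end
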